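import Summits.PneNP.PneNP.Theorems.ExpanderLinearGeneratorsResKClosure
import HarnessLib

/-!
# The `Res(k)` rung for expanding linear systems, V: width of the restricted XOR-CNF

Support file for `stmt-PneNP-11443`. The Ben-Sasson–Wigderson width bound for the XOR-CNF of a
linear system RESTRICTED by a partial assignment `ρ` of the kind produced by the closure (file I):
`ρ` assigns exactly a set `A` of variables containing all variables of a row family `Icl`, its
values satisfy the rows of `Icl`, and the rows outside `Icl` form an `(r', c')`-boundary expander
once the variables of `A` are disregarded (`RelExpander`). Then the empty clause is NOT derivable
from the restricted clause set `(sumEncoding 1 E)|ρ` in width `< c' r' / 2`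
(`not_resDerivable_empty_restrict`).

The proof is the row-level BSW argument of `LinearMapResolutionWidthProofs.lean` run relative to
`ρ`: the measure of a clause is the least number of rows OUTSIDE `Icl` implying it over assignments
AGREEING WITH `ρ`; boundary variables outside `A` can be flipped without leaving this class of
assignments. No restricted system is constructed — restricted clauses of closure rows are satisfied
by `ρ` and disappear, restricted clauses of the other rows are implied by their row relative to `ρ`.

[Ben-Sasson–Wigderson 2001, §5, Thm. 5.9 / Thm. 6.5; Alekhnovich 2011, §3 (the restricted system
inherits expansion)]
-/

namespace Summit.PneNP.PneNP.Theorems.ResKRestriction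

open Finset Literature.Computability.Complexity Literature.Computability.MetaComplexity

variable {m n : ℕ}

/-! ### Clauses of the XOR-CNF live on their row -/

/-- Every clause of `sumEncoding 1 E` is a clause of some row `k`: its variables are variables of
row `k`, and it is implied by the equation of row `k`. [Ben-Sasson–Wigderson 2001, §4.2] [folklore] -/
theorem exists_row_of_mem_clauseSet (E : Fin m → LinEqMod 2 n) {C : Finset (Literal ℕ)}
    (hC : C ∈ clauseSet (sumEncoding 1 E)) :
    ∃ k : Fin m, (∀ l ∈ C, l.1 ∈ rowVars E k) ∧
      ∀ σ : ℕ → Bool, (E k).Holds (blockVals 2 1 n σ) → finsetClauseEval σ C := by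
  obtain ⟨c, hc, rfl⟩ := mem_clauseSet_iff.1 hC
  simp only [sumEncoding, List.mem_flatMap, List.mem_finRange, true_and] at hc
  obtain ⟨k, hck⟩ := hc
  refine ⟨k, fun l hl => ?_, fun σ hσ => ?_⟩
  · have h1 := fst_mem_of_mem_canonicalCNF hck (List.mem_toFinset.1 hl)
    obtain ⟨i, hi, hv⟩ := mem_eqVars.1 h1
    rw [mem_encBlock] at hv
    obtain ⟨j, hj, hv⟩ := hv
    have : l.1 = i := by omega
    rw [this]
    exact val_mem_rowVars hi
  · have hev : (equationCNF 1 (E k)).eval σ = true := by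
      rw [eval_equationCNF]; exact decide_eq_true hσ
    have hcl : c.any (Literal.eval σ) = true := (CNF.eval_eq_true_iff _ _).1 hev c hck
    obtain ⟨l, hl, e⟩ := List.any_eq_true.1 hcl
    exact ⟨l, List.mem_toFinset.2 hl, e⟩

/-! ### Assignments agreeing with a restriction -/

/-- The total assignment `σ` AGREES with the partial assignment `ρ`. [folklore] -/
def Agrees (σ : ℕ → Bool) (ρ : ℕ → Option Bool) : Prop :=
  ∀ v b, ρ v = some b → σ v = b

/-- Flipping a variable unassigned by `ρ` preserves agreement. [folklore] -/
theorem Agrees.update {σ : ℕ → Bool} {ρ : ℕ → Option Bool} (h : Agrees σ ρ) {x : ℕ}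
    (hx : ρ x = none) (b : Bool) : Agrees (Function.update σ x b) ρ := by
  intro v b' hv
  rw [Function.update_of_ne]
  · exact h v b' hv
  · rintro rfl; rw [hx] at hv; exact absurd hv (by simp)

/-- The canonical total assignment of `ρ` (unassigned variables `false`) agrees with `ρ`. [folklore] -/
theorem agrees_getD (ρ : ℕ → Option Bool) : Agrees (fun v => (ρ v).getD false) ρ := by
  intro v b hv; simp [hv]

section Rel

variable (E : Fin m → LinEqMod 2 n) (Icl : Finset (Fin m)) (A : Finset ℕ) (ρ : ℕ → Option Bool)

/-- `RowsImplyRel E ρ I C`: over total assignments agreeing with `ρ`, the rows of `I` imply the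
clause `C`. [Ben-Sasson–Wigderson 2001, §5 (the measure `μ`)] [folklore] -/
def RowsImplyRel (I : Finset (Fin m)) (C : Finset (Literal ℕ)) : Prop :=
  ∀ σ : ℕ → Bool, Agrees σ ρ → (∀ i ∈ I, (E i).Holds (blockVals 2 1 n σ)) → finsetClauseEval σ C

variable {E Icl A ρ}

/-- **Relative satisfiability of small families**: if the rows outside `Icl` are an
`(r', c')`-expander relative to `A` (`c' > 0`) and `ρ` assigns only variables of `A`, then every
family of at most `r'` rows outside `Icl` is satisfied by an assignment agreeing with `ρ` (peel a
boundary variable outside `A` and flip it). [Ben-Sasson–Wigderson 2001, Thm. 6.5] [folklore] -/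
theorem exists_agrees_rows_hold {r' c' : ℝ} (hexp : RelExpander E Icl A r' c') (hc : 0 < c')
    (hρ : ∀ v, v ∉ A → ρ v = none) (I : Finset (Fin m)) (hdisj : Disjoint Icl I)
    (hIr : (I.card : ℝ) ≤ r') :
    ∃ σ : ℕ → Bool, Agrees σ ρ ∧ ∀ i ∈ I, (E i).Holds (blockVals 2 1 n σ) := by
  induction I using Finset.strongInduction with
  | H I ih =>
    rcases I.eq_empty_or_nonempty with rfl | hne
    · exact ⟨fun v => (ρ v).getD false, agrees_getD ρ, by simp⟩
    have h1 := hexp I hdisj hIr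
    have hpos : (0 : ℝ) < (((boundary (rowVars E) I) \ A).card : ℝ) :=
      lt_of_lt_of_le (mul_pos hc (by exact_mod_cast Finset.card_pos.2 hne)) h1
    obtain ⟨x, hx⟩ := Finset.card_pos.1 (by exact_mod_cast hpos)
    rw [Finset.mem_sdiff] at hx
    obtain ⟨i, hi, j, rfl, hji, huniq⟩ := exists_unique_row_of_mem_boundary E hx.1
    obtain ⟨σ, hσρ, hσ⟩ := ih (I.erase i) (Finset.erase_ssubset hi)
      (Finset.disjoint_of_subset_right (Finset.erase_subset _ _) hdisj)
      (le_trans (by exact_mod_cast Finset.card_le_card (Finset.erase_subset _ _)) hIr)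
    obtain ⟨b, hb, -⟩ := exists_flip_row E hji huniq hσ
    exact ⟨_, hσρ.update (hρ _ hx.2) b, hb⟩

/-- **Boundary variables outside `A` of a minimal implying family occur in the implied clause**
(BSW Thm. 5.9, relative to `ρ`). [Ben-Sasson–Wigderson 2001, Thm. 5.9] [folklore] -/
theorem boundary_sdiff_subset_clauseVars_of_minimal (hρ : ∀ v, v ∉ A → ρ v = none)
    {I : Finset (Fin m)} {C : Finset (Literal ℕ)} (hIC : RowsImplyRel E ρ I C)
    (hmin : ∀ i ∈ I, ¬ RowsImplyRel E ρ (I.erase i) C) :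
    (boundary (rowVars E) I) \ A ⊆ clauseVars C := by
  intro x hx
  rw [Finset.mem_sdiff] at hx
  obtain ⟨i, hi, j, rfl, hji, huniq⟩ := exists_unique_row_of_mem_boundary E hx.1
  by_contra hxC
  have h := hmin i hi
  unfold RowsImplyRel at h
  push Not at h
  obtain ⟨σ, hσρ, hσ, hσC⟩ := h
  obtain ⟨b, hb, hkeep⟩ := exists_flip_row E hji huniq hσ
  exact hσC ((hkeep C hxC).1 (hIC _ (hσρ.update (hρ _ hx.2) b) hb))

/-- **The relative width invariant.** Let `F` be a clause set every member of which is implied,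
relative to `ρ`, by one row outside `Icl`. If the rows outside `Icl` are an `(r', c')`-expander
relative to `A` (`c' > 0`, `r' ≥ 2`) and `ρ` assigns only variables of `A`, then every clause
derivable from `F` in width `w < c' r' / 2` is implied relative to `ρ` by a family of at most
`r'/2` rows outside `Icl`. [Ben-Sasson–Wigderson 2001, §5 (L. 5.2, 5.4, Thm. 5.9)] [folklore] -/
theorem exists_rows_imply_rel_of_resDerivable {r' c' : ℝ} (hexp : RelExpander E Icl A r' c')
    (hc : 0 < c') (hr : 2 ≤ r') (hρ : ∀ v, v ∉ A → ρ v = none)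
    {F : Set (Finset (Literal ℕ))}
    (hF : ∀ C ∈ F, ∃ k, k ∉ Icl ∧ RowsImplyRel E ρ {k} C)
    {w : ℕ} (hw : (w : ℝ) < c' * r' / 2) {C : Finset (Literal ℕ)} (hCd : ResDerivable F w C) :
    ∃ I : Finset (Fin m), Disjoint Icl I ∧ 2 * (I.card : ℝ) ≤ r' ∧ RowsImplyRel E ρ I C := by
  classical
  induction hCd with
  | ax hA hAR _ =>
    obtain ⟨k, hk, hkC⟩ := hF _ hA
    refine ⟨{k}, Finset.disjoint_singleton_right.2 hk, by simpa using hr, fun σ hσρ hσ => ?_⟩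
    obtain ⟨l, hl, e⟩ := hkC σ hσρ hσ
    exact ⟨l, hAR hl, e⟩
  | @res C₁ C₂ R v b _ _ hv₁ hv₂ hsub hRw ih₁ ih₂ =>
    obtain ⟨I₁, hI₁d, hI₁, hI₁C⟩ := ih₁
    obtain ⟨I₂, hI₂d, hI₂, hI₂C⟩ := ih₂
    have hU : RowsImplyRel E ρ (I₁ ∪ I₂) R := fun σ hσρ hσ =>
      finsetClauseEval_of_res (hI₁C σ hσρ fun i hi => hσ i (Finset.mem_union_left _ hi))
        (hI₂C σ hσρ fun i hi => hσ i (Finset.mem_union_right _ hi)) hsub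
    have hUd : Disjoint Icl (I₁ ∪ I₂) := Finset.disjoint_union_right.2 ⟨hI₁d, hI₂d⟩
    have hUr : ((I₁ ∪ I₂).card : ℝ) ≤ r' := by
      have h' : ((I₁ ∪ I₂).card : ℝ) ≤ I₁.card + I₂.card := by
        exact_mod_cast Finset.card_union_le I₁ I₂
      linarith
    obtain ⟨J, hJmem, hJmin⟩ := Finset.exists_min_image
      ((I₁ ∪ I₂).powerset.filter fun J => RowsImplyRel E ρ J R) Finset.card
      ⟨I₁ ∪ I₂, Finset.mem_filter.2 ⟨Finset.mem_powerset.2 subset_rfl, hU⟩⟩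
    rw [Finset.mem_filter, Finset.mem_powerset] at hJmem
    obtain ⟨hJU, hJR⟩ := hJmem
    have hmin : ∀ i ∈ J, ¬ RowsImplyRel E ρ (J.erase i) R := by
      intro i hi himp
      have := hJmin (J.erase i) (Finset.mem_filter.2
        ⟨Finset.mem_powerset.2 ((Finset.erase_subset _ _).trans hJU), himp⟩)
      rw [Finset.card_erase_of_mem hi] at this
      have := Finset.card_pos.2 ⟨i, hi⟩
      omega
    have hbd := boundary_sdiff_subset_clauseVars_of_minimal hρ hJR hmin
    have hJd : Disjoint Icl J := Finset.disjoint_of_subset_right hJU hUd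
    have hJr : (J.card : ℝ) ≤ r' := le_trans (by exact_mod_cast Finset.card_le_card hJU) hUr
    have h1 : c' * J.card ≤ ((((boundary (rowVars E) J)) \ A).card : ℝ) := hexp J hJd hJr
    have h2 : ((((boundary (rowVars E) J)) \ A).card : ℝ) ≤ w := by
      exact_mod_cast ((Finset.card_le_card hbd).trans (card_clauseVars_le R)).trans hRw
    refine ⟨J, hJd, ?_, hJR⟩
    have h3 : c' * J.card < c' * r' / 2 := by linarith
    have h4 : (J.card : ℝ) < r' / 2 := by
      rw [mul_div_assoc] at h3
      exact lt_of_mul_lt_mul_left h3 hc.le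
    linarith

/-- **No narrow refutation relative to `ρ`.** Under the hypotheses of
`exists_rows_imply_rel_of_resDerivable`, the empty clause is not derivable from `F` in width
`< c' r' / 2`. [Ben-Sasson–Wigderson 2001, Thm. 6.5] [folklore] -/
theorem not_resDerivable_empty_rel {r' c' : ℝ} (hexp : RelExpander E Icl A r' c')
    (hc : 0 < c') (hr : 2 ≤ r') (hρ : ∀ v, v ∉ A → ρ v = none)
    {F : Set (Finset (Literal ℕ))}
    (hF : ∀ C ∈ F, ∃ k, k ∉ Icl ∧ RowsImplyRel E ρ {k} C)
    {w : ℕ} (hw : (w : ℝ) < c' * r' / 2) : ¬ ResDerivable F w ∅ := by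
  intro hD
  obtain ⟨I, hId, hI, hIE⟩ := exists_rows_imply_rel_of_resDerivable hexp hc hr hρ hF hw hD
  obtain ⟨σ, hσρ, hσ⟩ := exists_agrees_rows_hold hexp hc hρ I hId
    (by linarith [(Nat.cast_nonneg I.card : (0 : ℝ) ≤ I.card)])
  obtain ⟨l, hl, -⟩ := hIE σ hσρ hσ
  simp at hl

end Rel

/-! ### The restricted XOR-CNF -/

/-- **Restricted clauses are implied by their (non-closure) row, relative to `ρ`.** Suppose `ρ`
assigns exactly the variables of `A`, every row of `Icl` has its variables in `A` and is satisfied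
by the values of `ρ`. Then every clause of `(sumEncoding 1 E)|ρ` is implied relative to `ρ` by a
single row outside `Icl`. [Alekhnovich 2011, §3; Ben-Sasson–Wigderson 2001, §4.2] [folklore] -/
theorem exists_row_rel_of_mem_restrictFormula {E : Fin m → LinEqMod 2 n} {Icl : Finset (Fin m)}
    {A : Finset ℕ} {ρ : ℕ → Option Bool}
    (hρA : ∀ v, ρ v = none ↔ v ∉ A) (hcl : ∀ i ∈ Icl, rowVars E i ⊆ A)
    (hsat : ∀ i ∈ Icl, (E i).Holds (blockVals 2 1 n fun v => (ρ v).getD false))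
    {C : Finset (Literal ℕ)} (hC : C ∈ restrictFormula ρ (clauseSet (sumEncoding 1 E))) :
    ∃ k, k ∉ Icl ∧ RowsImplyRel E ρ {k} C := by
  obtain ⟨C₀, hC₀, hns, rfl⟩ := hC
  obtain ⟨k, hvars, himp⟩ := exists_row_of_mem_clauseSet E hC₀
  -- a literal of `C₀` on an assigned variable that is true under an agreeing assignment
  -- would make `ρ` satisfy `C₀`
  have key : ∀ σ : ℕ → Bool, Agrees σ ρ → ∀ l ∈ C₀, l.eval σ = true → ρ l.1 = none := by
    intro σ hσρ l hl e
    cases hρl : ρ l.1 with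
    | none => rfl
    | some b =>
      exfalso
      have hσl : σ l.1 = b := hσρ _ _ hρl
      have hb : b = l.2 := by
        simp [Literal.eval] at e; rw [← hσl, e]
      exact hns ⟨l, hl, by rw [hρl, hb]⟩
  refine ⟨k, fun hk => ?_, fun σ hσρ hσ => ?_⟩
  · -- closure rows: every literal is assigned; the row holds under `ρ`'s values, so `C₀` would be satisfied
    obtain ⟨l, hl, e⟩ := himp _ (hsat k hk)
    have h1 := key _ (agrees_getD ρ) l hl e
    exact (hρA l.1).1 h1 (hcl k hk (hvars l hl))
  · obtain ⟨l, hl, e⟩ := himp σ (hσ k (Finset.mem_singleton_self k))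
    exact ⟨l, mem_restrictClause.2 ⟨hl, key σ hσρ l hl e⟩, e⟩

/-- **Width lower bound for the restricted XOR-CNF.** Let `ρ` assign exactly the variables of
`A ⊇ vars(Icl)` with values satisfying the rows of `Icl`, and let the rows outside `Icl` be an
`(r', c')`-boundary expander relative to `A` (`c' > 0`, `r' ≥ 2`). Then the empty clause is not
derivable from `(sumEncoding 1 E)|ρ` in width `w < c' r' / 2`.
[Ben-Sasson–Wigderson 2001, Thm. 6.5; Alekhnovich 2011, §3–4] [folklore] -/
theorem not_resDerivable_empty_restrict {E : Fin m → LinEqMod 2 n} {Icl : Finset (Fin m)}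
    {A : Finset ℕ} {ρ : ℕ → Option Bool} {r' c' : ℝ}
    (hexp : RelExpander E Icl A r' c') (hc : 0 < c') (hr : 2 ≤ r')
    (hρA : ∀ v, ρ v = none ↔ v ∉ A) (hcl : ∀ i ∈ Icl, rowVars E i ⊆ A)
    (hsat : ∀ i ∈ Icl, (E i).Holds (blockVals 2 1 n fun v => (ρ v).getD false))
    {w : ℕ} (hw : (w : ℝ) < c' * r' / 2) :
    ¬ ResDerivable (restrictFormula ρ (clauseSet (sumEncoding 1 E))) w ∅ :=
  not_resDerivable_empty_rel hexp hc hr (fun v hv => (hρA v).2 hv)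
    (fun _ hC => exists_row_rel_of_mem_restrictFormula hρA hcl hsat hC) hw

end Summit.PneNP.PneNP.Theorems.ResKRestriction
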